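import Mathlib.Analysis.Calculus.MeanValue
import Literature.Analysis.Approximation.MarkovInequality
import HarnessLib

/-!
# The Ehlich–Zeller / Rivlin–Cheney degree bound (Beals et al., Thm. 4.12)

**The printed statement** (R. Beals, H. Buhrman, R. Cleve, M. Mosca, R. de Wolf, *Quantum lower
bounds by polynomials*, J. ACM 48 (2001), Thm. 4.12, quoting Ehlich–Zeller 1964 and
Rivlin–Cheney 1966): "Let `p : ℝ → ℝ` be a polynomial such that `b₁ ≤ p(i) ≤ b₂` for every
integer `0 ≤ i ≤ N`, and `|p'(x)| ≥ c` for some real `0 ≤ x ≤ N`. Then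
`deg(p) ≥ √(cN / (c + b₂ - b₁))`." We prove it in the squared form
`c N ≤ deg(p)² (c + b₂ - b₁)` (`ehlichZeller_rivlinCheney`, with `c > 0`, the case in which the
printed bound has content), and record the special case used in the proof of Beals et al.
Thm. 4.13: `0 ≤ r(i) ≤ 1` on the integers `0..b`, `r(0) ≤ 1/3`, `r(1) ≥ 2/3` force
`b ≤ 4 deg(r)²` (`le_four_mul_natDegree_sq`).

**Proof** (the standard one, e.g. Nisan–Szegedy 1994, Lemma 3.3 / Buhrman–de Wolf 2002, §2.5):
let `c' = max_{[0,N]} |p'| ≥ c`. Every `x ∈ [0, N]` is within `1/2` of an integer `i ≤ N`, so by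
the mean value theorem `b₁ - c'/2 ≤ p(x) ≤ b₂ + c'/2` on `[0, N]`. Markov's inequality on
`[0, N]` (`markov_inequality_Icc`, applied to `p - (b₁+b₂)/2`) gives
`c' ≤ deg(p)² (b₂ - b₁ + c') / N`, and `t ↦ t/(t + b₂ - b₁)` is monotone, whence the claim
with `c ≤ c'`.

## References

* R. Beals, H. Buhrman, R. Cleve, M. Mosca, R. de Wolf, *Quantum lower bounds by polynomials*,
  J. ACM 48 (2001) 778–797, Thm. 4.12 and the proof of Thm. 4.13 (arXiv:quant-ph/9802049,
  p. 9) [BealsEtAl2001].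
* H. Ehlich, K. Zeller, *Schwankung von Polynomen zwischen Gitterpunkten*, Math. Z. 86 (1964)
  41–44; T. J. Rivlin, E. W. Cheney, *A comparison of uniform approximations on an interval and
  a finite subset thereof*, SIAM J. Numer. Anal. 3 (1966) 311–320 (original sources).
-/

open Polynomial Real Finset

namespace Literature.Analysis.Approximation

/-- **Ehlich–Zeller / Rivlin–Cheney** (Beals et al. Thm. 4.12: "Let `p` be a polynomial such
that `b₁ ≤ p(i) ≤ b₂` for every integer `0 ≤ i ≤ N`, and `|p'(x)| ≥ c` for some real
`0 ≤ x ≤ N`. Then `deg(p) ≥ √(cN/(c + b₂ - b₁))`"), squared form with `c > 0`: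
`c N ≤ deg(p)² · (c + b₂ - b₁)` (`deg = natDegree`). [cite: BealsEtAl2001, Thm 4.12] -/
theorem ehlichZeller_rivlinCheney {p : ℝ[X]} {N : ℕ} {b₁ b₂ c : ℝ} (hc : 0 < c)
    (hb : ∀ i : ℕ, i ≤ N → b₁ ≤ p.eval (i : ℝ) ∧ p.eval (i : ℝ) ≤ b₂)
    (hξ : ∃ ξ ∈ Set.Icc (0 : ℝ) N, c ≤ |(derivative p).eval ξ|) :
    c * N ≤ (p.natDegree : ℝ) ^ 2 * (c + b₂ - b₁) := by
  obtain ⟨ξ, hξI, hcξ⟩ := hξ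
  have hB : b₁ ≤ b₂ := (hb 0 (Nat.zero_le N)).1.trans (hb 0 (Nat.zero_le N)).2
  rcases Nat.eq_zero_or_pos N with rfl | hN
  · simp only [Nat.cast_zero, mul_zero]
    exact mul_nonneg (by positivity) (by linarith)
  have hN' : (0 : ℝ) < N := by exact_mod_cast hN
  -- maximum of `|p'|` on `[0, N]`
  obtain ⟨xs, hxsI, hmax⟩ := (isCompact_Icc (a := (0 : ℝ)) (b := N)).exists_isMaxOn
    (Set.nonempty_Icc.mpr hN'.le)
    ((derivative p).differentiable.continuous.abs.continuousOn :
      ContinuousOn (fun x => |(derivative p).eval x|) _)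
  set c' := |(derivative p).eval xs| with hc'
  have hcc' : c ≤ c' := hcξ.trans (hmax hξI)
  -- Lipschitz bound from the derivative bound
  have hlip : ∀ x ∈ Set.Icc (0 : ℝ) N, ∀ y ∈ Set.Icc (0 : ℝ) N,
      |p.eval y - p.eval x| ≤ c' * |y - x| := by
    intro x hx y hy
    have := (convex_Icc (0 : ℝ) N).norm_image_sub_le_of_norm_deriv_le
      (f := fun z => p.eval z) (fun z _ => p.differentiableAt)
      (fun z hz => by rw [Polynomial.deriv]; exact hmax hz) hx hy
    simpa using this
  -- `p` stays within `c'/2` of `[b₁, b₂]` on `[0, N]`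
  have hrange : ∀ x ∈ Set.Icc (0 : ℝ) N, |p.eval x - (b₁ + b₂) / 2| ≤ (b₂ - b₁ + c') / 2 := by
    intro x hx
    set i := ⌊x + 1 / 2⌋₊ with hi
    have hx0 : 0 ≤ x + 1 / 2 := by linarith [hx.1]
    have hi1 : (i : ℝ) ≤ x + 1 / 2 := Nat.floor_le hx0
    have hi2 : x + 1 / 2 < i + 1 := Nat.lt_floor_add_one _
    have hiN : i ≤ N := by
      have : i < N + 1 := (Nat.floor_lt hx0).mpr (by push_cast; linarith [hx.2])
      omega
    have hiI : (i : ℝ) ∈ Set.Icc (0 : ℝ) N := ⟨Nat.cast_nonneg _, by exact_mod_cast hiN⟩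
    have hdist : |x - i| ≤ 1 / 2 := abs_le.mpr ⟨by linarith, by linarith⟩
    have h1 := hlip _ hiI x hx
    obtain ⟨hb1, hb2⟩ := hb i hiN
    have h2 : |p.eval x - p.eval (i : ℝ)| ≤ c' / 2 := by
      refine h1.trans ?_
      have : 0 ≤ c' := abs_nonneg _
      nlinarith
    rw [abs_le] at h2 ⊢
    constructor <;> linarith [h2.1, h2.2]
  -- Markov on `[0, N]` applied to `p - C μ`
  set μ := (b₁ + b₂) / 2
  have hdeg : (p - C μ).degree ≤ p.natDegree :=
    (degree_sub_le _ _).trans (max_le (degree_le_natDegree) (degree_C_le.trans (by simp)))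
  have hmk := markov_inequality_Icc hdeg hN' (M := (b₂ - b₁ + c') / 2)
    (fun y hy => by simpa using hrange y hy) hxsI
  rw [derivative_sub, derivative_C, sub_zero, ← hc', sub_zero] at hmk
  -- `c' ≤ d² (b₂ - b₁ + c') / N`
  have key : c' * N ≤ (p.natDegree : ℝ) ^ 2 * (b₂ - b₁ + c') := by
    rw [le_div_iff₀ hN'] at hmk
    linarith
  -- monotonicity in `c`
  by_cases hd : (N : ℝ) ≤ (p.natDegree : ℝ) ^ 2
  · nlinarith
  · push Not at hd
    nlinarith [hcc', key, hd]

/-- **Ehlich–Zeller / Rivlin–Cheney, printed form** (Beals et al. Thm. 4.12):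
`deg(p) ≥ √(cN / (c + b₂ - b₁))`. [cite: BealsEtAl2001, Thm 4.12] -/
theorem sqrt_le_natDegree_of_bounds {p : ℝ[X]} {N : ℕ} {b₁ b₂ c : ℝ} (hc : 0 < c)
    (hb : ∀ i : ℕ, i ≤ N → b₁ ≤ p.eval (i : ℝ) ∧ p.eval (i : ℝ) ≤ b₂)
    (hξ : ∃ ξ ∈ Set.Icc (0 : ℝ) N, c ≤ |(derivative p).eval ξ|) :
    Real.sqrt (c * N / (c + b₂ - b₁)) ≤ p.natDegree := by
  have h := ehlichZeller_rivlinCheney hc hb hξ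
  have hB : b₁ ≤ b₂ := (hb 0 (Nat.zero_le N)).1.trans (hb 0 (Nat.zero_le N)).2
  have hpos : 0 < c + b₂ - b₁ := by linarith
  rw [Real.sqrt_le_left (Nat.cast_nonneg _), div_le_iff₀ hpos]
  linarith

/-- The special case used by Beals et al. in the proof of Thm. 4.13 ("`0 ≤ r(i) ≤ 1` for every
integer `0 ≤ i ≤ b`, and for some `x ∈ [0,1]` we have `r'(x) ≥ 1/3` because `r(0) ≤ 1/3` and
`r(1) ≥ 2/3`. Applying the previous theorem we get `deg(r) ≥ √(b/4)`"): a real polynomial `r`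
with `0 ≤ r(i) ≤ 1` at the integers `0 ≤ i ≤ b` (`b ≥ 1`), `r(0) ≤ 1/3` and `r(1) ≥ 2/3` has
`b ≤ 4 · deg(r)²`. [cite: BealsEtAl2001, Thm 4.13 (proof)] -/
theorem le_four_mul_natDegree_sq {r : ℝ[X]} {b : ℕ} (hb : 1 ≤ b)
    (h01 : ∀ i : ℕ, i ≤ b → 0 ≤ r.eval (i : ℝ) ∧ r.eval (i : ℝ) ≤ 1)
    (h0 : r.eval 0 ≤ 1 / 3) (h1 : 2 / 3 ≤ r.eval 1) : b ≤ 4 * r.natDegree ^ 2 := by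
  -- mean value theorem on `[0, 1]`
  obtain ⟨ξ, hξ, hξd⟩ := exists_deriv_eq_slope (fun x => r.eval x) zero_lt_one
    r.differentiable.continuous.continuousOn (fun x _ => r.differentiableAt.differentiableWithinAt)
  rw [Polynomial.deriv] at hξd
  have hc : (1 / 3 : ℝ) ≤ |(derivative r).eval ξ| := by
    rw [hξd]; norm_num
    exact le_trans (by linarith) (le_abs_self _)
  have hξI : ξ ∈ Set.Icc (0 : ℝ) b :=
    ⟨hξ.1.le, hξ.2.le.trans (by exact_mod_cast hb)⟩
  have h := ehlichZeller_rivlinCheney (b₁ := 0) (b₂ := 1) (by norm_num : (0 : ℝ) < 1 / 3) h01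
    ⟨ξ, hξI, hc⟩
  have : (b : ℝ) ≤ 4 * (r.natDegree : ℝ) ^ 2 := by linarith
  exact_mod_cast this

end Literature.Analysis.Approximation
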